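import Summits.HubbardSuperconductivity.HubbardSuperconductivity.Theorems.AnisotropyChordTransferExclusionGap

/-!
# Route `AnisotropyChord` / H0 rotor rung, route (1): the exclusion Poincaré inequality on `(ℤ/L)^d` in EVERY DIMENSION

`…TransferTorusPoincare` proves the one-particle Poincaré inequality of `(ℤ/L)^d` in shift form for every `d`
(`torus_poincare_shift`) but its graph form, and hence `exclusionGap_torus`, only for `d = 2`.  This file removes the restriction:

* `sum_adj_torus_ge` — on `torusGraph d L`, `L ≥ 3`: `Σᵢ (F(x + eᵢ) + F(x − eᵢ)) ≤ Σ_y [x ∼ y] F y` for `F ≥ 0` (the `2d` points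
  `x ± eᵢ` are distinct neighbours of `x`);
* `torus_poincare_adj_dim` — `(1 − cos(2π/L)) Σ_x ‖g x‖² ≤ ¼ Σ_x Σ_y [x ∼ y] ‖g x − g y‖²` for `Σ g = 0`, every `d`, `L ≥ 3`;
* **`exclusionGap_torus_dim`** — for `d ≥ 1`, `L ≥ 3`, every real amplitude `ψ` on `(ℤ/L)^d → Fin 2` supported on one particle-number
  sector with `Σ ψ = 0`: `(1 − cos(2π/L)) Σ ψ² ≤ ⟨ψ, fmOp ψ⟩` (symmetric exclusion / stirring on the `d`-dimensional torus has at least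
  the one-particle gap in every sector; `exclusion_poincare_of_rw_gap` + Caputo–Liggett–Richthammer).

Prover seat `hubbard-h0-rotor-p1` g20; helper for the S-bridge dossier of stmt-HubbardSuperconductivity-19089 (the `d = 3` case is the
sharp form of the interchange comparison used elsewhere for lattice bosons).  No definition is introduced.
-/

set_option linter.dupNamespace false
set_option autoImplicit false

noncomputable section

open Finset Complex
open Literature.MathematicalPhysics.QuantumLattice Literature.Probability.LatticeModels
open Summit.HubbardSuperconductivity.HubbardSuperconductivity.Theorems.AnisotropyChord.Tower

namespace Summit.HubbardSuperconductivity.HubbardSuperconductivity.Theorems.AnisotropyChord.Transfer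

variable {d L : ℕ} [NeZero L]

omit [NeZero L] in
/-- the backward neighbour `x − eᵢ` is adjacent to `x` on `torusGraph d L` (`L ≥ 2`). [folklore] -/
theorem torusGraph_adj_sub_single (hL : 2 ≤ L) (x : TorusSite d L) (i : Fin d) :
    (torusGraph d L).Adj x (x - Pi.single i 1) := by
  rw [torusGraph_adj_iff]
  refine ⟨fun h => torus_single_ne_zero hL i ?_, Or.inr ⟨i, by rw [sub_add_cancel]⟩⟩
  have h' : x + (-Pi.single i 1) = x := by rw [← sub_eq_add_neg]; exact h.symm
  exact neg_eq_zero.mp (add_eq_left.mp h')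

/-- **the neighbour sum dominates the sum over the `2d` lattice neighbours** (`L ≥ 3`, non-negative summand). [folklore] -/
theorem sum_adj_torus_ge (hL : 3 ≤ L) (x : TorusSite d L) (F : TorusSite d L → ℝ) (hF : ∀ y, 0 ≤ F y) :
    ∑ i : Fin d, (F (x + Pi.single i 1) + F (x - Pi.single i 1))
      ≤ ∑ y, (if (torusGraph d L).Adj x y then F y else 0) := by
  classical
  have hL2 : 2 ≤ L := by omega
  haveI : Fact (1 < L) := ⟨by omega⟩
  -- `eᵢ + eⱼ ≠ 0` for `L ≥ 3`
  have hee : ∀ i j : Fin d, (Pi.single i 1 : TorusSite d L) + Pi.single j 1 ≠ 0 := by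
    intro i j h
    have hi := congrFun h i
    by_cases hij : j = i
    · subst hij
      simp only [Pi.add_apply, Pi.single_eq_same, Pi.zero_apply] at hi
      have h2 : ((2 : ℕ) : ZMod L) = 0 := by
        have : (1 : ZMod L) + 1 = ((2 : ℕ) : ZMod L) := by norm_num
        rw [this] at hi
        exact hi
      rw [ZMod.natCast_eq_zero_iff] at h2
      have := Nat.le_of_dvd (by norm_num) h2
      omega
    · simp only [Pi.add_apply, Pi.single_eq_same, Pi.single_eq_of_ne (Ne.symm hij), Pi.zero_apply,
        add_zero] at hi
      exact one_ne_zero hi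
  have hsingle : ∀ i j : Fin d, (Pi.single i 1 : TorusSite d L) = Pi.single j 1 → i = j := by
    intro i j h
    by_contra hij
    have := congrFun h i
    rw [Pi.single_eq_same, Pi.single_eq_of_ne hij] at this
    exact one_ne_zero this
  -- the `2d` neighbours as an injective family
  let nb : Fin d ⊕ Fin d → TorusSite d L := Sum.elim (fun i => x + Pi.single i 1) (fun i => x - Pi.single i 1)
  have hinj : Function.Injective nb := by
    rintro (i | i) (j | j) h <;> simp only [nb, Sum.elim_inl, Sum.elim_inr] at h
    · exact congrArg Sum.inl (hsingle i j (add_left_cancel h))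
    · exfalso
      apply hee i j
      have h2 : x + (Pi.single i 1 + Pi.single j 1) = x := by rw [← add_assoc, h, sub_add_cancel]
      exact add_eq_left.mp h2
    · exfalso
      apply hee j i
      have h2 : x + (Pi.single j 1 + Pi.single i 1) = x := by rw [← add_assoc, ← h, sub_add_cancel]
      exact add_eq_left.mp h2
    · exact congrArg Sum.inr (hsingle i j (sub_right_inj.mp h))
  have hadj : ∀ p, (torusGraph d L).Adj x (nb p) := by
    rintro (i | i)
    · exact torusGraph_adj_add_single hL2 x i
    · exact torusGraph_adj_sub_single hL2 x i
  calc ∑ i : Fin d, (F (x + Pi.single i 1) + F (x - Pi.single i 1))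
      = ∑ p : Fin d ⊕ Fin d, F (nb p) := by
        rw [Fintype.sum_sum_type, Finset.sum_add_distrib]
        simp only [nb, Sum.elim_inl, Sum.elim_inr]
    _ = ∑ y ∈ Finset.univ.map ⟨nb, hinj⟩, F y := by rw [Finset.sum_map]; rfl
    _ = ∑ y ∈ Finset.univ.map ⟨nb, hinj⟩, (if (torusGraph d L).Adj x y then F y else 0) := by
        refine Finset.sum_congr rfl fun y hy => ?_
        obtain ⟨p, -, rfl⟩ := Finset.mem_map.mp hy
        exact (if_pos (hadj p)).symm
    _ ≤ ∑ y, (if (torusGraph d L).Adj x y then F y else 0) :=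
        Finset.sum_le_sum_of_subset_of_nonneg (Finset.subset_univ _) fun y _ _ => by
          split_ifs
          · exact hF y
          · exact le_refl _

/-- **ONE-PARTICLE POINCARÉ INEQUALITY ON THE TORUS GRAPH `(ℤ/L)^d`, `L ≥ 3`, every `d`:** for `Σ_x g x = 0`,
`(1 − cos(2π/L)) Σ_x ‖g x‖² ≤ ¼ Σ_x Σ_y [x ∼ y] ‖g x − g y‖²`. [folklore] -/
theorem torus_poincare_adj_dim (hL : 3 ≤ L) (g : TorusSite d L → ℂ) (hg : ∑ x, g x = 0) :
    (1 - Real.cos (2 * Real.pi / L)) * ∑ x, ‖g x‖ ^ 2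
      ≤ (1 / 4 : ℝ) * ∑ x, ∑ y, (if (torusGraph d L).Adj x y then ‖g x - g y‖ ^ 2 else 0) := by
  have hL2 : 2 ≤ L := by omega
  have h1 := torus_poincare_shift hL2 g hg
  have hback : ∀ i : Fin d,
      ∑ x, ‖g x - g (x - Pi.single i 1)‖ ^ 2 = ∑ x, ‖g (x + Pi.single i 1) - g x‖ ^ 2 := by
    intro i
    exact (Fintype.sum_equiv (Equiv.addRight (Pi.single i (1 : ZMod L)))
      (fun x => ‖g (x + Pi.single i 1) - g x‖ ^ 2) (fun x => ‖g x - g (x - Pi.single i 1)‖ ^ 2)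
      (fun x => by simp)).symm
  have hfour : ∑ x, ∑ i : Fin d, (‖g x - g (x + Pi.single i 1)‖ ^ 2 + ‖g x - g (x - Pi.single i 1)‖ ^ 2)
      ≤ ∑ x, ∑ y, (if (torusGraph d L).Adj x y then ‖g x - g y‖ ^ 2 else 0) :=
    Finset.sum_le_sum fun x _ => sum_adj_torus_ge hL x (fun y => ‖g x - g y‖ ^ 2) (fun y => sq_nonneg _)
  have hsplit : ∑ x, ∑ i : Fin d, (‖g x - g (x + Pi.single i 1)‖ ^ 2 + ‖g x - g (x - Pi.single i 1)‖ ^ 2)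
      = 2 * ∑ x, ∑ i : Fin d, ‖g (x + Pi.single i 1) - g x‖ ^ 2 := by
    rw [two_mul]
    simp only [Finset.sum_add_distrib]
    congr 1
    · refine Finset.sum_congr rfl fun x _ => Finset.sum_congr rfl fun i _ => ?_
      rw [norm_sub_rev]
    · rw [Finset.sum_comm, Finset.sum_congr rfl fun i _ => hback i]
      exact Finset.sum_comm
  rw [hsplit] at hfour
  linarith

/-- **EXCLUSION POINCARÉ INEQUALITY ON `(ℤ/L)^d` (`d ≥ 1`, `L ≥ 3`), every particle-number sector:** a real amplitude
supported on `{zerosCard = n}` with `Σ_σ ψ σ = 0` has `(1 − cos(2π/L)) Σ ψ² ≤ ⟨ψ, fmOp ψ⟩` — the symmetric exclusion (stirring)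
process on the `d`-dimensional torus has at least the one-particle gap in every sector. [cite: CaputoLiggettRichthammer2010, Theorem 1.1] -/
theorem exclusionGap_torus_dim (hd : 1 ≤ d) (hL : 3 ≤ L) (n : ℝ) (ψ : (TorusSite d L → Fin 2) → ℝ)
    (hsupp : ∀ σ, ψ σ ≠ 0 → zerosCard σ = n) (hmean : ∑ σ, ψ σ = 0) :
    (1 - Real.cos (2 * Real.pi / L)) * ∑ σ, ψ σ ^ 2 ≤ ∑ σ, ψ σ * fmOp (torusGraph d L) ψ σ := by
  have hcard : Fintype.card (TorusSite d L) = L ^ d := by simp [ZMod.card]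
  have hV : 2 ≤ Fintype.card (TorusSite d L) := by
    rw [hcard]
    calc 2 ≤ 3 := by norm_num
      _ ≤ L := hL
      _ = L ^ 1 := (pow_one L).symm
      _ ≤ L ^ d := Nat.pow_le_pow_right (by omega) hd
  exact exclusion_poincare_of_rw_gap (torusGraph d L) hV _ (fun g hg => torus_poincare_adj_dim hL g hg) _ ψ hsupp hmean

end Summit.HubbardSuperconductivity.HubbardSuperconductivity.Theorems.AnisotropyChord.Transfer

end
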